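import Summits.QuantumFields.YangMills.Theorems.NPointIsotropy.Negative.ModelBlindFalse
import Summits.QuantumFields.YangMills.Theorems.CurvatureBoostCovariance.Negative.OnAllTestsFalse
import Summits.QuantumFields.YangMills.Theorems.CurvatureBoostCovariance.Negative.BetaZeroTie
import Literature.MathematicalPhysics.QuantumLattice.GaugeGroupsProofs
import Summits.QuantumFields.YangMills.Theorems.NPointIsotropy.Negative.BoostWeights

/-!
# Disproof of `NPointIsotropy` — standing disprover's work file (crux stmt-QuantumFields-11686)

Route `PencilRigidity`, crux #3 `NPointIsotropy` (card K2, the n-point upgrade):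
`∀ G r sch S₁, W₁ r sch S₁ → EightFrameRP S₁ → RadialKernel S₁ → PlanarInvariant S₁`.

VERDICT SO FAR (end of cycle 3): **no kill; the crux as typed is insulated by the lattice TIE and by nothing
else** (cycles 1–2), **and the regular model-blind core behind the picked line has NO counterexample in the whole
Borchers class of (dressed) generalised free fields** (cycle 3, §11: a theorem, not a search). Every clause that speaks
about `S₁` alone (OS package, sixteen-frame RP, both gaps, the radial continuous two-point kernel) is reachable by junk
that violates the conclusion; the tie at order `4` is what excludes the junk; and every scheme `(r, sch)` whose tie we
can certify (`c ≡ 0`; `β_k = 0` frequently) ties only families that satisfy the conclusion. A counterexample to the CRUX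
is an anisotropic gapped Wilson scaling limit of the `tr F²` channel with radial two-point function — open at the level
of the existence problem itself. A counterexample to the LINE's bet (`stub_harmonicKill`, the regular core) must be an
OS family in sixteen frames that is not a local function of reflection-positive generalised free fields (§11(d)) — in
four dimensions nothing of the kind is constructible.

This file was RECONSTRUCTED at the start of cycle 2 (the cycle-1 work file, item evidence
`20260816T000817Z-Disproof.lean`, is not readable from the compute-free hub; its conclusive content is LANDED as
files I–IV below and is imported, not re-proved) and then EXTENDED (§2–§7).

## Findings index

* §1 (cycle 1; LANDED `Theorems/NPointIsotropy/Negative/{HyperoctahedralPlane, JunkFamily, JunkInvariance,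
  ModelBlindFalse}`, p69502 / p70190 / p70892 / p71514): the MODEL-BLIND form (both lattice clauses dropped) is
  false — the junk family `𝔖₀ = 1, 𝔖₄ = J, 𝔖ₙ = 0` (`J` = `W(B₄) × S₄`-symmetrised integration over the 7-plane of
  patterns `x, x + s e₃, x + t e₂, x + u e₀`) meets E0, E0h, E0', E2 in EVERY frame `R e₀ ∈ span(e₀,e₁)`, E3, E4,
  `HasMassGap Δ` for every `Δ`, translations, full hypercubic invariance, `K = 0`, and `𝔖₄(R₀·F₀) = 0 ≠ 𝔖₄(F₀)`.
  Mechanism: from `n = 4` on, the exceptional set `𝔈ₙ` (an equal-"time" pair in each of the 16 frames) is not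
  inside the coincidence locus, and distributions supported on it are invisible to every typed OS clause.
* §2 (cycle 2; file V `Negative/TieLoadBearing.lean`, p72179 ACCEPTED; re-certified here): the TIE AT ORDER 4
  is load-bearing — `NPointIsotropyWithoutTieAt4` (tie kept at every order `≠ 4`, `HasLatticeMassGap` and all
  else kept) is FALSE (`G = SU(2)`, fundamental `r`, zero scheme, junk); hence `WithoutTie` is false and the
  lattice GAP is not what protects the crux. `WithoutLatticeGap → crux` recorded; not cheaply refutable.
* §3 (cycle 2; file VI `Negative/OnAllTestsFalse.lean`, p72239 ACCEPTED; re-certified here): the natural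
  strengthening "conclusion on all of `𝓢`" is FALSE (`S♯` of the sibling crux, half-turn `diag(-1,-1,1,1)`).
* §4 non-vacuity WITH the radial kernel: vacuum + zero scheme inhabit `W1 ∧ EightFrameRP ∧ RadialKernel` for every
  `G, r` (and satisfy the conclusion).
* §4b (cycle 3): the remaining one-hypothesis drops `WithoutRadialKernel`, `WithoutEightFrameRP` (and `Hypercubic`)
  are TIE-INSULATED — implied-by-crux direction recorded, inhabited with the conclusion by every certified tie, no witness
  possible short of an anisotropic Wilson limit; the load-bearing table is complete: only the tie is refutably necessary.
* §5 slices on which the conclusion is PROVED on off-diagonal real tensors (imported from the sibling disprover's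
  landed `β ≡ 0` collapse): every `c ≡ 0` scheme (for EVERY isometry, from the tie alone); every scheme with
  `β_k = 0` frequently (c-number field; modulo planar invariance of the one-point distribution, §6a).
* §6 near-misses (sorried, with obstruction): (a) translation-invariant one-point distributions are constants.
* §7 WHY IT RESISTS / open directions (docstrings): certified-regime analysis; the REGULAR model-blind form that
  layer-2 children must carry (`NPointIsotropyRegularModelBlind`, junk-proof by a continuity clause, no
  counterexample known); the index-locking E2 obstruction; the `J_N` programme (tie at every order `N ≥ 4`);
  and the COMPUTATION of cycle 2 (item evidence `ModelBlindSearch.md` + scripts): in the 4D free field, NO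
  `W(B₄)`-scalar Wick bilinear `B` of derivative order ≤ 6 (single field, two fields, mixed orders; massless AND
  generic radial `G`) has an exactly radial `⟨BB⟩` unless it is an `O(4)`-scalar mod null operators — exact jet
  calculus over ℚ + certified sliced Newton (0 real solutions on 30 + 16 generic slices although the complex solution
  sets have positive dimension; solver validated on a relaxed system) — so the cheapest regular model-blind
  counterexample `s = ψ + εB` does not exist up to order 8 (massless; MASSIVE free field — jets reduced by the Bessel ODE — and generic `G` are more overdetermined and empty too); momentum-space reading:
  `⟨BB⟩` radial ⇔ `Σ_ℓ c_ℓ (k²)^ℓ‖Π_ℓ P_ℓ(ik)‖² ≡ C(k²)^{2d}`, a sum of NON-NEGATIVE anisotropic terms — conjectured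
  free-field no-go.
* §9 (cycle 2; file VIII `Negative/PlanarGenericJunk.lean`, p73365 ACCEPTED): NOTES FOR THE LEAD ON THE TWO LIVE CARDS.
  Both `quarter-turn-corner-operator` (mop-up step) and `entire-complex-angle-bandlimit` (density step) extend
  invariance from test functions with frame-split / planar-generic supports to all of `⁰𝒮` "by density and
  continuity". Model-blind this step is FALSE from degree 4 on: `J_eq_zero_of_planar_generic` — the junk functional
  `J` (every typed OS clause in all sixteen frames, translations, hypercubic symmetry, gap, `K = 0`) vanishes on EVERY
  test function vanishing at planar-degenerate configurations (two points with equal `(x₀,x₁)`-projection), yet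
  `J F₀ ≠ 0 = J (R₀·F₀)` (`planar_generic_not_determining`). Functions flat on the coincidence locus are not limits of
  functions vanishing at planar-degenerate configurations; the step must import the Wilson tie AT THE ORDER IN
  QUESTION, or a continuity clause for `𝔖ₙ` off the coincidence locus (with which values on the dense open generic
  set do determine `𝔖ₙ|⁰𝒮`). At degree 3 no import is needed PROVIDED all sixteen frames are used (§8,
  `three_points_frame_separated`); the four planar directions alone do not separate `(0, e₂, e₀)`. The cards'
  falsifiers "(2)/(3): tuned two-free-field Wick class" are the computation of §7b: no bilinear solution up to
  derivative order 8; the class must be enlarged (trilinear / non-Wick) to have a chance.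
* §10 (cycle 2; file IX `Negative/DegreeTwoFree.lean`, p73769 ACCEPTED): degree 2 of the conclusion is FREE —
  `radialKernel_invariant_two`: the radial-kernel hypothesis alone gives `𝔖₂(R·F) = 𝔖₂(F)` on `⁰𝒮` for EVERY linear
  isometry (invariance of Lebesgue measure on `(ℝ⁴)²`); with degree 0 trivial and degree 1 = §6a, the n-point step
  starts at degree 3, where §8 says every configuration is frame-separated, and the first junk is in degree 4 (§1–§2, §9).
* §8 (cycle 2; file VII `Negative/FrameSeparation.lean`, p73110 ACCEPTED): the junk threshold is EXACTLY
  `n = 4` — `three_points_frame_separated` (every non-coincident configuration of three points of `ℝ⁴` has pairwise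
  distinct pairings with one of the sixteen mirror normals `e_μ, e_μ ± e_ν`; 81 + 729 linear cases) and
  `four_points_not_frame_separated` (`0, 10e₃, 10e₂, 10e₀` is equal-time in every frame). So `𝔈₃` is the
  coincidence locus: degrees `≤ 3` of a `W(B₄)`-symmetric family are read off `⁰𝒮` by sixteen-frame time-ordered
  data, and distributions invisible to every typed OS clause exist exactly in degrees `≥ 4`.
* §11 (cycle 3; THEOREM on paper, full proof in the docblock; certified instance §11b = file XI
  `Negative/RadialBilinearOrderFour.lean` p83468: at order 4 the top harmonic is a positive definite form): **the Borchers-class no-go.**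
  For independent e₀-reflection-positive generalised free fields `φ_a` with polynomial dressings `A_a ≥ 0` on shell
  (free fields, derivative fields `N(−i∂)φ`, the sixteen-frame family `(1 + ε e₂²)/(p²+m²)` of `Unbundled.lean`), and ANY
  Hermitian local Wick polynomial `s` in them: `⟨ss⟩` radial off `0` ⟹ every sector function `|M̄_σ|² ∏ A` is
  Lorentz-invariant ⟹ anisotropically dressed constituents are absent and `s ≡` an `SO(4)`-scalar Wick polynomial mod
  null fields ⟹ ALL `𝔖ₙ` are `SO(4)`-invariant. Inputs: Lorentz invariance of the spectral measure of `Ψ_s` (MODEL-BLIND: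
  e₀-RP + `RadialKernel` only) and the ambient boost of free Fock space (finite-dimensional weight spaces + positivity of
  top weights). So the falsifier class named in the skeleton for `stub_harmonicKill` is EMPTY at all orders (supersedes
  the order-≤-8 search of §7b); the sixteen frames, the gap and clustering are not even needed inside this class.
* §12 (cycle 3): consequences for the lead — the degree-3 case of the crux is Lorentz invariance of the FORM FACTOR
  kernel of `s(0)` on the translation-cyclic space `L²(V₊, μ_{Ψ_s})` (which carries a canonical unitary Lorentz action in
  each of the sixteen frames); what the line's band-limit/positivity substitute lacks is the identity tying `𝔖ₙ` to `μ_v`;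
  bookkeeping: the `L¹`-residual regular form proved by stubs 2–6 implies the continuity-residual form of §7b
  (`regularModelBlind_of_L1`).
* §13 (cycle 3, paper): structure of sixteen-frame two-point functions — anisotropic regular inhabitants
  `A(−i∂)G_m` (`A ≥ 0` on the sixteen shells) exist and are `O(4)`-finite; chain RP(e₀,n,n') ⟹ planar cone (two-slot
  sector + Lukacs growth) ⟹ entire orbit functions of type = temperedness order ⟹ `O(4)`-finite: `AngularBandLimited`
  at `n = 2` holds for every family of the crux (`K(2) ≤ M'/4`); certified engine `Negative/BoostWeights.lean`.
-/

noncomputable section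

-- Mathlib's `SimplexCategory` instance `Fintype (Fin (x.len + 1))` matches `Fintype (Fin 4)` (tree-known workaround).
attribute [-instance] SimplexCategory.instFintypeToTypeOrderHomFinHAddNatLenOfNat

namespace Summit.QuantumFields.YangMills.Cruxes.NPointIsotropy.Disproof

open scoped BigOperators SchwartzMap
open MeasureTheory Filter Topology
open Literature.MathematicalPhysics.QuantumLattice Literature.MathematicalPhysics.AQFT
  Literature.MathematicalPhysics.QuantumFieldTheory
open Summit.QuantumFields.YangMills.Theorems.NPointIsotropy.Negative
open Summit.QuantumFields.YangMills.Theorems.CurvatureBoostCovariance.Negative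
  (OSPackage Translations Hypercubic EightFrameRP PlanarInvariant PlanarInvariantOnAllTests Tie Gaps W1 vac sharp
    hypotheses_vac hypotheses_sharp vac_of_ne_zero sharp_of_ne sharp_three_apply
    latticeSchwinger_eq_zero_of_c_eq_zero apply_linActMulti_eq_of_c_eq_zero apply_linActMulti_eq_of_beta_zero
    isOffDiagonal_linActMulti halfTurn det_halfTurn halfTurn_single_two halfTurn_single_three halfTurn_symm_e1
    exists_bump_three)

/-! ## §0 The crux unbundled -/

/-- The radial-kernel hypothesis of the crux (verbatim). -/
def RadialKernel (S₁ : SchwingerFamily E4) : Prop :=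
  ∃ K : E4 → ℝ, ContinuousOn K {x : E4 | x ≠ 0} ∧ (∀ (R : E4 ≃ₗᵢ[ℝ] E4) (x : E4), x ≠ 0 → K (R x) = K x) ∧
    ∀ F : 𝓢((Fin 2 → E4), ℂ), IsOffDiagonal F →
      MeasureTheory.Integrable (fun x : Fin 2 → E4 => (K (x 0 - x 1) : ℂ) * F x) ∧
      S₁ 2 F = ∫ x : Fin 2 → E4, (K (x 0 - x 1) : ℂ) * F x

/-- The crux, unbundled (definitional). -/
theorem crux_iff :
    Summit.QuantumFields.YangMills.Theses.PencilRigidity.NPointIsotropy ↔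
      ∀ (G : Type) [Group G] [TopologicalSpace G] [IsTopologicalGroup G] [CompactSpace G],
        IsCompactSimpleLieGroup G →
        letI : MeasurableSpace G := borel G
        haveI : BorelSpace G := ⟨rfl⟩
        ∀ (r : LatticeRep G) (sch : SpeciesScheme (YMSpecies G)) (S₁ : SchwingerFamily E4),
          W1 r sch S₁ → EightFrameRP S₁ → RadialKernel S₁ → PlanarInvariant S₁ :=
  Iff.rfl

/-- A family vanishing on `⁰𝒮` in degree `2` has the radial kernel `K = 0`. -/
theorem radialKernel_of_two_eq_zero (S₁ : SchwingerFamily E4)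
    (h : ∀ F : 𝓢((Fin 2 → E4), ℂ), IsOffDiagonal F → S₁ 2 F = 0) : RadialKernel S₁ :=
  ⟨fun _ => 0, continuousOn_const, fun _ _ _ => rfl, fun F hF => ⟨by simp, by simp [h F hF]⟩⟩

/-- `K = 0` for the vacuum family. -/
theorem radialKernel_vac : RadialKernel vac :=
  radialKernel_of_two_eq_zero _ fun F _ => by rw [vac_of_ne_zero two_ne_zero]; rfl

/-- `K = 0` for the junk family. -/
theorem radialKernel_junk : RadialKernel junk :=
  radialKernel_of_two_eq_zero _ fun F _ => by
    rw [junk_of_ne (show (2 : ℕ) ≠ 0 by decide) (show (2 : ℕ) ≠ 4 by decide)]; rfl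

/-- `K = 0` for `S♯`. -/
theorem radialKernel_sharp : RadialKernel sharp :=
  radialKernel_of_two_eq_zero _ fun F _ => by
    rw [sharp_of_ne (by decide : (2 : ℕ) ≠ 3), vac_of_ne_zero two_ne_zero]; rfl

/-- `SU(2)` is a certified compact simple Lie group (tree: `isSimpleCompactGroup_specialUnitaryGroup_holds`). -/
theorem su2_isCompactSimpleLieGroup : IsCompactSimpleLieGroup (Matrix.specialUnitaryGroup (Fin 2) ℂ) :=
  isCompactSimpleLieGroup_specialUnitaryGroup isSimpleCompactGroup_specialUnitaryGroup_holds le_rfl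

/-- The fundamental lattice representation of `SU(2)`. -/
def su2Fund : LatticeRep (Matrix.specialUnitaryGroup (Fin 2) ℂ) :=
  ⟨2, fundamentalRep (Fin 2), continuous_fundamentalRep _, fundamentalRep_injective _,
    fundamentalRep_mem_unitaryGroup⟩

/-! ## §1 Cycle 1 (landed files I–IV): the model-blind form is false -/

/-- INDEX ENTRY for cycle 1: `¬ NPointIsotropyModelBlind` (file IV, p71514). -/
theorem modelBlind_false : ¬ NPointIsotropyModelBlind := not_NPointIsotropyModelBlind

/-! ## §2 Cycle 2: the tie AT ORDER 4 is the load-bearing clause (file V, p72179) -/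

/-- The crux with the tie required at every order `n ≠ 4` only (everything else, incl. `HasLatticeMassGap`, kept). -/
def WithoutTieAt4 : Prop :=
  ∀ (G : Type) [Group G] [TopologicalSpace G] [IsTopologicalGroup G] [CompactSpace G],
    IsCompactSimpleLieGroup G →
    letI : MeasurableSpace G := borel G
    haveI : BorelSpace G := ⟨rfl⟩
    ∀ (r : LatticeRep G) (sch : SpeciesScheme (YMSpecies G)) (S₁ : SchwingerFamily E4),
      ((∀ (n : ℕ), n ≠ 0 → n ≠ 4 → ∀ (f : Fin n → 𝓢(E4, ℝ)) (F : 𝓢((Fin n → E4), ℂ)),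
          IsTensorOf F (fun i => ofRealTest (f i)) → IsOffDiagonal F →
            Tendsto (fun k : ℕ => ((latticeSchwinger r.ρ sch (fun s => s.F) k n
              (fun _ => r.curvature) f : ℝ) : ℂ)) atTop (𝓝 (S₁ n F))) ∧
        OSPackage S₁ ∧ Translations S₁ ∧ Hypercubic S₁ ∧ Gaps r sch S₁) →
      EightFrameRP S₁ → RadialKernel S₁ → PlanarInvariant S₁

/-- `WithoutTieAt4 → crux`. -/
theorem crux_of_withoutTieAt4 (h : WithoutTieAt4) :
    Summit.QuantumFields.YangMills.Theses.PencilRigidity.NPointIsotropy := by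
  rw [crux_iff]
  intro G _ _ _ _ hG r sch S₁ hW h8 hK
  exact h G hG r sch S₁ ⟨fun n hn _ f F hF hF' => hW.1 n hn f F hF hF', hW.2⟩ h8 hK

section

variable {G : Type} [Group G] [TopologicalSpace G] [IsTopologicalGroup G] [CompactSpace G]
  [MeasurableSpace G] [BorelSpace G]

/-- The junk family is tied at every order `≠ 4` to every `c ≡ 0` scheme (both sides vanish). -/
theorem junk_tie_of_ne_four (r : LatticeRep G) (sch : SpeciesScheme (YMSpecies G))
    (hc : ∀ k, sch.c r.curvature k = 0) {n : ℕ} (hn : n ≠ 0) (h4 : n ≠ 4) (f : Fin n → 𝓢(E4, ℝ))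
    (F : 𝓢((Fin n → E4), ℂ)) :
    Tendsto (fun k : ℕ => ((latticeSchwinger r.ρ sch (fun s => s.F) k n (fun _ => r.curvature) f : ℝ) : ℂ))
      atTop (𝓝 (junk n F)) := by
  have h0 : ∀ k, ((latticeSchwinger r.ρ sch (fun s => s.F) k n (fun _ => r.curvature) f : ℝ) : ℂ) = 0 :=
    fun k => by rw [latticeSchwinger_eq_zero_of_c_eq_zero r sch hc k hn, Complex.ofReal_zero]
  simp only [h0, junk_of_ne hn h4]
  exact tendsto_const_nhds

/-- The junk family satisfies every hypothesis of `WithoutTieAt4` (any `G`, any `r`, zero scheme). -/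
theorem junk_hypotheses (r : LatticeRep G) :
    ((∀ (n : ℕ), n ≠ 0 → n ≠ 4 → ∀ (f : Fin n → 𝓢(E4, ℝ)) (F : 𝓢((Fin n → E4), ℂ)),
        IsTensorOf F (fun i => ofRealTest (f i)) → IsOffDiagonal F →
          Tendsto (fun k : ℕ => ((latticeSchwinger r.ρ (SpeciesScheme.zero (YMSpecies G)) (fun s => s.F) k n
            (fun _ => r.curvature) f : ℝ) : ℂ)) atTop (𝓝 (junk n F))) ∧
      OSPackage junk ∧ Translations junk ∧ Hypercubic junk ∧ Gaps r (SpeciesScheme.zero (YMSpecies G)) junk) ∧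
    EightFrameRP junk ∧ RadialKernel junk :=
  ⟨⟨fun _ hn h4 f F _ _ => junk_tie_of_ne_four r _ (fun _ => rfl) hn h4 f F,
    ⟨junk_isNormalized, junk_isHermitian, junk_hasLinearGrowth, junk_rp, junk_isSymmetric,
      junk_hasClusterProperty⟩,
    fun n a F _ => junk_translate n a F,
    fun _ _ hR n F _ => junk_hyper n hR F,
    ⟨1, one_pos, junk_hasMassGap 1,
      Theorems.LatticeGapOnTrajectory.Negative.hasLatticeMassGap_of_zero_coupling r _ (fun _ => rfl) 1⟩⟩,
    fun R a b _ _ hR => junk_frame_rp R a b hR, radialKernel_junk⟩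

end

/-- **The tie at order 4 is load-bearing**: `WithoutTieAt4` is false (`SU(2)`, fundamental `r`, zero scheme,
junk, `K = 0`; `𝔖₄(R₀·F₀) = 0 ≠ 𝔖₄(F₀)`). -/
theorem not_withoutTieAt4 : ¬ WithoutTieAt4 := by
  intro h
  letI : MeasurableSpace (Matrix.specialUnitaryGroup (Fin 2) ℂ) := borel _
  haveI : BorelSpace (Matrix.specialUnitaryGroup (Fin 2) ℂ) := ⟨rfl⟩
  obtain ⟨hW, h8, hK⟩ := junk_hypotheses su2Fund
  exact not_conclusionOf_junk (h _ su2_isCompactSimpleLieGroup su2Fund (SpeciesScheme.zero _) junk hW h8 hK)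

/-! ## §3 Cycle 2: the strengthening "conclusion on all of `𝓢`" is false (file VI, p72239) -/

/-- The crux with `IsOffDiagonal F →` deleted from the conclusion. -/
def OnAllTests : Prop :=
  ∀ (G : Type) [Group G] [TopologicalSpace G] [IsTopologicalGroup G] [CompactSpace G],
    IsCompactSimpleLieGroup G →
    letI : MeasurableSpace G := borel G
    haveI : BorelSpace G := ⟨rfl⟩
    ∀ (r : LatticeRep G) (sch : SpeciesScheme (YMSpecies G)) (S₁ : SchwingerFamily E4),
      W1 r sch S₁ → EightFrameRP S₁ → RadialKernel S₁ → PlanarInvariantOnAllTests S₁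

/-- `OnAllTests → crux`. -/
theorem crux_of_onAllTests (h : OnAllTests) :
    Summit.QuantumFields.YangMills.Theses.PencilRigidity.NPointIsotropy := by
  rw [crux_iff]
  intro G _ _ _ _ hG r sch S₁ hW h8 hK R hR h2 h3 n F _
  exact h G hG r sch S₁ hW h8 hK R hR h2 h3 n F

/-- **The strengthening is false**: `S♯` (vacuum + degree-3 evaluation at `(e₁,e₁,e₁)`), zero scheme, `K = 0`,
half-turn `diag(-1,-1,1,1)`. Message to provers: prove invariance ON `⁰𝒮`; nothing pins a tied family at
coincident points. -/
theorem not_onAllTests : ¬ OnAllTests := by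
  intro h
  letI : MeasurableSpace (Matrix.specialUnitaryGroup (Fin 2) ℂ) := borel _
  haveI : BorelSpace (Matrix.specialUnitaryGroup (Fin 2) ℂ) := ⟨rfl⟩
  obtain ⟨hW, h8, -, -⟩ := hypotheses_sharp su2Fund
  have key := h _ su2_isCompactSimpleLieGroup su2Fund (SpeciesScheme.zero _) sharp hW h8 radialKernel_sharp
    halfTurn det_halfTurn halfTurn_single_two halfTurn_single_three 3
  obtain ⟨F, hF1, hF0⟩ := exists_bump_three
  have h1 := key F
  rw [sharp_three_apply, sharp_three_apply, linActMulti_apply] at h1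
  simp only [halfTurn_symm_e1] at h1
  rw [hF0, hF1] at h1
  exact zero_ne_one h1

/-! ## §4 Non-vacuity with the radial kernel -/

section

variable {G : Type} [Group G] [TopologicalSpace G] [IsTopologicalGroup G] [CompactSpace G]
  [MeasurableSpace G] [BorelSpace G]

/-- For EVERY `G`, `r`: zero scheme + vacuum family satisfy all hypotheses of the crux and its conclusion. So the
crux is not vacuous; and (with §1–§2) junk reaches every clause except the tie. -/
theorem hypotheses_vac_radial (r : LatticeRep G) :
    W1 r (SpeciesScheme.zero _) vac ∧ EightFrameRP vac ∧ RadialKernel vac ∧ PlanarInvariant vac := by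
  obtain ⟨hW, h8, -, hP⟩ := hypotheses_vac r
  exact ⟨hW, h8, radialKernel_vac, hP⟩

/-! ## §4b (cycle 3) The remaining one-hypothesis drops: all TIE-INSULATED (recorded, no witness possible today)

Dropping `RadialKernel`, `EightFrameRP` or `Hypercubic` from the crux while KEEPING the tie gives statements that are
implied by nothing we can refute: every scheme whose tie we can certify (`c ≡ 0`: `S₁|⁰𝒮 = 0` in degrees `≥ 1`, §5;
`β_k = 0` frequently: c-number field, §5) ties only families satisfying `PlanarInvariant` outright, whatever else is
dropped, and an anisotropic tied family is a genuine anisotropic Wilson scaling limit (§7a). Conversely each of these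
clauses IS reachable by junk once the tie is dropped (§1–§2: junk has `K = 0`, sixteen-frame RP and full hypercubic
symmetry). So the load-bearing table of the crux is complete: the tie (at the order in question, §2, §7c) is the only
clause whose removal is refuted; every `S₁`-only clause is individually "possibly unnecessary" in the refuter's sense —
no information for the prover beyond "the tie must be consumed". (Inside the regular model-blind core the situation is
the opposite: there `RadialKernel` is the unique separating hypothesis, DREFUTE §B / §13.) -/

/-- The crux with the radial-kernel hypothesis dropped. Tie-insulated (§4b); implies the crux. -/
def WithoutRadialKernel : Prop :=
  ∀ (G : Type) [Group G] [TopologicalSpace G] [IsTopologicalGroup G] [CompactSpace G],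
    IsCompactSimpleLieGroup G →
    letI : MeasurableSpace G := borel G
    haveI : BorelSpace G := ⟨rfl⟩
    ∀ (r : LatticeRep G) (sch : SpeciesScheme (YMSpecies G)) (S₁ : SchwingerFamily E4),
      W1 r sch S₁ → EightFrameRP S₁ → PlanarInvariant S₁

/-- `WithoutRadialKernel → crux`. -/
theorem crux_of_withoutRadialKernel (h : WithoutRadialKernel) :
    Summit.QuantumFields.YangMills.Theses.PencilRigidity.NPointIsotropy := by
  rw [crux_iff]
  intro G _ _ _ _ hG r sch S₁ hW h8 _
  exact h G hG r sch S₁ hW h8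

/-- The crux with the eight planar frames dropped (only the `e₀`-frame E2 of `W1`, transported to the four axes by
`Hypercubic`, remains: no diagonal mirror). Tie-insulated (§4b); implies the crux. Note for planners: whether Wilson's
action is reflection positive across the DIAGONAL lattice planes `x⁰ = x¹` is not used anywhere on the negative side;
`EightFrameRP` is a hypothesis on the limit, inhabited by every certified tie. -/
def WithoutEightFrameRP : Prop :=
  ∀ (G : Type) [Group G] [TopologicalSpace G] [IsTopologicalGroup G] [CompactSpace G],
    IsCompactSimpleLieGroup G →
    letI : MeasurableSpace G := borel G
    haveI : BorelSpace G := ⟨rfl⟩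
    ∀ (r : LatticeRep G) (sch : SpeciesScheme (YMSpecies G)) (S₁ : SchwingerFamily E4),
      W1 r sch S₁ → RadialKernel S₁ → PlanarInvariant S₁

/-- `WithoutEightFrameRP → crux`. -/
theorem crux_of_withoutEightFrameRP (h : WithoutEightFrameRP) :
    Summit.QuantumFields.YangMills.Theses.PencilRigidity.NPointIsotropy := by
  rw [crux_iff]
  intro G _ _ _ _ hG r sch S₁ hW _ hK
  exact h G hG r sch S₁ hW hK

section

variable {G : Type} [Group G] [TopologicalSpace G] [IsTopologicalGroup G] [CompactSpace G]
  [MeasurableSpace G] [BorelSpace G]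

/-- Both drops are inhabited, with the conclusion, by every certified tie: e.g. zero scheme + vacuum (any `G`, `r`). -/
theorem withoutDrops_inhabited (r : LatticeRep G) :
    W1 r (SpeciesScheme.zero _) vac ∧ EightFrameRP vac ∧ RadialKernel vac ∧ PlanarInvariant vac :=
  hypotheses_vac_radial r

end

/-! ## §5 Slices of scheme space on which the conclusion is PROVED (on off-diagonal real tensors)

The tie PINS `S₁` on off-diagonal real tensors (`tie_unique`, sibling file `Unbundled`), whose span is dense in
`⁰𝒮` (paper: cut-off near the coincidence locus using flatness + Fejér tensor approximation on disjoint product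
boxes); so the truth value of the crux is that of "every tied family is planar-invariant on tensors". On the two
families of schemes whose tie we can compute, it is: -/

/-- **`c ≡ 0` slice** (e.g. the zero scheme): a tied family is invariant on off-diagonal real tensors under EVERY
linear isometry — from the tie alone (both sides vanish). -/
theorem conclusion_on_tensors_of_c_eq_zero {r : LatticeRep G} {sch : SpeciesScheme (YMSpecies G)}
    {S₁ : SchwingerFamily E4} (hW : W1 r sch S₁) (hc : ∀ k, sch.c r.curvature k = 0) (R : E4 ≃ₗᵢ[ℝ] E4)
    {n : ℕ} (hn : n ≠ 0) (f : Fin n → 𝓢(E4, ℝ)) (F : 𝓢((Fin n → E4), ℂ))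
    (hF : IsTensorOf F fun i => ofRealTest (f i)) (hF' : IsOffDiagonal F) :
    S₁ n (linActMulti R F) = S₁ n F :=
  apply_linActMulti_eq_of_c_eq_zero hW.1 hc R hn f F hF hF'

/-- **`β_k = 0` frequently** (arbitrary `c_k, m_k, a_k, L_k`, any faithful `r`): a tied family is a c-number field
on tensors (`tie_beta_zero_factorises`), so the conclusion for EVERY linear isometry `R` reduces to
`R`-invariance of the one-point distribution `S₁ 1` — which is translation invariant by `W₁`, hence (§6a, on
paper) `κ · dx`. So a counterexample needs `β_k ≠ 0` for all large `k`; with `β_k` bounded and small the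
plaquette field is exponentially clustering in lattice units (Osterwalder–Seiler 1978) hence ultralocal in
physical units (barrier `FixedCouplingUltralocality`), and with `β_k → ∞` too fast the lattice theory is
Gaussian–massless and fails `HasLatticeMassGap`: the only remaining regime is the genuine scaling window. -/
theorem conclusion_on_tensors_of_beta_zero (r : LatticeRep G) (sch : SpeciesScheme (YMSpecies G))
    (hβ : ∃ᶠ k in atTop, sch.β k = 0) {S₁ : SchwingerFamily E4} (hW : W1 r sch S₁) (R : E4 ≃ₗᵢ[ℝ] E4)
    (h1 : ∀ (g : 𝓢(E4, ℝ)) (G₁ : 𝓢((Fin 1 → E4), ℂ)), IsTensorOf G₁ (fun _ => ofRealTest g) →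
      S₁ 1 (linActMulti R G₁) = S₁ 1 G₁)
    {n : ℕ} (hn : n ≠ 0) (f : Fin n → 𝓢(E4, ℝ)) (F : 𝓢((Fin n → E4), ℂ))
    (hF : IsTensorOf F fun i => ofRealTest (f i)) (hF' : IsOffDiagonal F) :
    S₁ n (linActMulti R F) = S₁ n F :=
  apply_linActMulti_eq_of_beta_zero r sch hβ hW.1 R h1 hn f F hF hF'

end

/-! ## §6 Near-misses (sorried; obstruction recorded) -/

/-- **§6a (near-miss). A translation-invariant continuous linear functional on `𝓢(ℝ⁴, ℂ)` is a multiple of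
Lebesgue integration.** Standard (`T(τ_a φ) = T φ ⇒ T(∂ⱼφ) = 0 ⇒ T = κ ∫`, or `supp T̂ ⊆ {0}`), and it would
discharge `h1` of `conclusion_on_tensors_of_beta_zero` (the one-point distribution of a `W₁`-family is
translation invariant on all of `𝓢`, `⁰𝒮₁ = 𝓢`), closing the `β ≡ 0` slice outright.
OBSTRUCTION (Lean, not mathematics): Mathlib has no Schwartz-space-valued Bochner integral (𝓢 is Fréchet, not
Banach) for `T(ψ ∗ φ) = ∫ ψ(a) T(τ_a φ) da`, no convergence of difference quotients `(τ_{h eⱼ} φ − φ)/h → −∂ⱼφ`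
in the Schwartz topology, and no "`∫ φ = 0 ⇒ φ = Σⱼ ∂ⱼ ψⱼ` in `𝓢`" (Hadamard-type division); any of the three
routes is ≳ 10³ lines. Tried: direct Riemann-sum route through the tie (`S₁ 1 f = lim c_k(6d₀ − m_k)·a_k⁴ Σ f(a_k y)`)
— needs Riemann-sum convergence for Schwartz functions on expanding fine boxes, also absent. -/
theorem translationInvariant_eq_const_integral (T : 𝓢((Fin 1 → E4), ℂ) →L[ℂ] ℂ)
    (hT : ∀ (a : E4) (F : 𝓢((Fin 1 → E4), ℂ)), T (translateMulti a F) = T F) :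
    ∃ κ : ℂ, ∀ F : 𝓢((Fin 1 → E4), ℂ), T F = κ * ∫ x, F x := by
  sorry

/-! ## §7 WHY IT RESISTS — and what a layer-2 child must carry

**§7a Certified regimes.** A counterexample is `(G, r, sch, S₁)` with `S₁|⁰𝒮` = the Wilson scaling limit of the
renormalised `tr F²` strings (tie + density), anisotropic at some order `n ≥ 3` (orders `≤ 2` are invariant
outright: `𝔖₁ = κ∫` and `𝔖₂ = ∫ K(x₀−x₁)·` with `K` radial), carrying OS + both gaps. Regimes we can compute:
`c ≡ 0` (zero on tensors, §5); `β_k = 0` frequently (c-number field, §5); `β_k` small bounded (cluster expansion: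
range-`O(1)` correlations in lattice units ⇒ only disconnected parts survive on `⁰𝒮` ⇒ `κⁿ`, isotropic — not
formalised); `β_k → ∞` faster than any scaling (lattice Gaussian/Maxwell regime: isotropic limit AND polynomial
lattice clustering, so `HasLatticeMassGap` fails by its uniformity in the volume `S`). What is left is the
genuine confining scaling window `a_k ξ_lat(β_k) ≍ 1` — the Millennium existence problem. Negative `β` (allowed by
`SpeciesScheme`) is frustrated on odd tori (`∏_{plane} U_p = 1` vs `(−1)^{odd}`) and uncontrolled; amplifying
exponentially small bounded-`β` correlations by `c_k → ∞` diverges at shorter physical distances (no tempered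
limit for all tensors).

**§7b The REGULAR model-blind form** (`NPointIsotropyRegularModelBlind` below) is what the planner's layer-2
children (`RadialWedgeStandardness → ModularBoostCovarianceRadial`) must at least assume: junk (§1–§2) is
singular (supported on the 7-plane family inside `𝔈₄`), so a continuity clause for `𝔖ₙ|⁰𝒮` off the coincidence
locus excludes it, and such a clause is exactly what `CurvatureKernelBound` provides at `n = 2` only. NO
counterexample to the regular form is known to this disprover. Attempts (paper): (i) Wick polynomials of
O(4)-invariant generalised free fields that are `W(B₄)`- but not `O(4)`-scalars (`Σ_μ :(∂_μ²ψ)²:`, …) have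
anisotropic two-point functions; exact radiality of `⟨ss⟩` for `s = A + Σ λⱼ Bⱼ` is an identity between radial
coefficient FUNCTIONS, solvable by finitely many `λⱼ` only under scale invariance (massless `ψ`: all coefficients
are powers; e.g. the `O(ε)` anisotropy of `:ψ²: + ε(Σ:(∂_μ²ψ)²: − (1/6)Σ:ψ∂_μ⁴ψ:)` cancels since
`64 r⁻¹² Σx_μ⁴` and `384 r⁻¹² Σx_μ⁴` are proportional) — but then there is no mass gap, and the `O(ε²)` term
`⟨BB⟩` must be radial too; in a unitary CFT, `⟨AB⟩ = 0` for a scalar primary `A` and the cubic contraction `B` of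
a spin-`ℓ ≥ 4` primary, while `⟨BB⟩ = Σ_T C_T r^{-2Δ_T} a_ℓ(x̂)` with `C_T > 0` and e.g.
`a₄ ∝ −4 + 24p₄/r⁴ − 32p₆/r⁶ + 16p₄²/r⁸` anisotropic, so radiality of `⟨BB⟩` needs cancellation ACROSS spins of
fixed-sign families. COMPUTED in cycle 2 (item evidence `ModelBlindSearch.md` v2, scripts `radial_bilinear_search.py`,
`rbcore.py`, `curve_check.py`, `slice_newton.py`; exact over ℚ): for `s = ψ + εB` (so only `⟨BB⟩` must be radial,
and `⟨ψψB⟩` certifies anisotropy) there is NO real `W(B₄)`-scalar bilinear `B` with radial `⟨BB⟩` outside the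
isotropic/null subspace, for derivative order 4 (7 unknowns, 3 quadrics — triangular by hand), order 6 (18 unknowns,
dim N = 11, 6 quadrics; 0 certified real zeros on 30 generic slices × 300 Newton starts, the linearisation at `N`
has rank 2 and the second order is obstructed), two-field bilinears `:∂^αψ₁∂^βψ₂:` of order ≤ 6 (32 unknowns,
6 quadrics, 0 real zeros on 16 slices although the complex zero set has projective dimension ≥ 6), and mixed orders
0..3 jointly; order 8 massless (50 unknowns, dim N = 29, 13 quadrics; 0 real zeros on 20 generic slices of the reduced
22-unknown system, solver validated at that size); the MASSIVE free field (jets reduced by `4u g'' + 8g' = M²g`: 11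
resp. 39 quadrics at orders 4, 6) and generic radial `G` (GFF; 16/79/161/269 quadrics) are overdetermined with no
zeros. Conjectured FREE-FIELD NO-GO: a `W(B₄)`-scalar Wick bilinear with
radial two-point function is an `O(4)`-scalar modulo null operators (momentum space: `Σ_ℓ c_ℓ(k²)^ℓ‖Π_ℓP_ℓ(ik)‖²`
is a sum of non-negative anisotropic terms). (ii) Internal-index
locking (`s = Σ_μ (∂_μφ_μ) η_μ`, eight independent scalar free fields) gives `⟨ss⟩ = E·(−ΔG)` exactly radial with
anisotropic `⟨ssss⟩`, but `−ΔG_M = −M² G_M` off `0` is ANTI-reflection-positive and, more basically, a locked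
composite is not `θ`-covariant as a scalar (`Θ[s(x)] = s̃(θx)`, `s̃ = s − 2(∂₀φ₀)η₀`), so E2 in pull-back form for
the one-species family fails (at the two-point level here; at the four-point level for `θ`-even lockings such as
`Σ_μ (∂_μ²φ_μ)η_μ`, where the diagonal mirrors need the internal swap `φ₀ ↔ φ₁`, which is not a positive
involution). (iii) Products `:χ₁χ₂:` of independent anisotropic 16-RP Gaussians with `C₁C₂` radial, or sums with
`C₁ + C₃` radial and `C₁ ≠ C₃`: the additive version with domination `|μ_D| ≤ μ_R` along the 16 pencils is the
rank-2 crux `ShellRigidity`'s own question (dressed Källén–Lehmann class); the multiplicative version is open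
(decay-rate norms `τ₁ + τ₂ = const·|x|` are unobstructed). MORAL: below the typed hypotheses, "radial two-point ⇒
isotropic n-point" has neither a proof idea beyond generalised free fields (Gaier–Yngvason 2000: boost covariance
is two-point data only for GFFs) nor a counterexample; the crux's truth value is that of a universality statement
for gapped Wilson limits.

**§7c The `J_N` programme** (not formalised): for every `N ≥ 4`, `𝔖_N := W(B₄) × S_N`-symmetrised integration over
patterns `(x, x+se₃, x+te₂, x+ue₀, w₅, …, w_N)` (free extra points) is expected to satisfy every typed OS clause
and to be non-invariant against `F₀ ⊗ (bumps at 10³k(e₂+e₃))` (a rotated axis vector has never both `e₂`- and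
`e₃`-components large, so the structured points cannot straddle clusters; inside the near cluster the cycle-1
`no_fit` applies) — i.e. the tie is load-bearing AT EVERY ORDER `N ≥ 4` separately.
-/

/-- **The REGULAR model-blind form** (the honest layer-2 statement; see §7b): OS package + translations + proper
hypercubic invariance + continuum gap + eight-frame RP + radial kernel + CONTINUITY of every `𝔖ₙ|⁰𝒮` off the
coincidence locus ⇒ planar invariance on `⁰𝒮`. Junk-proof by the continuity clause; no counterexample known;
no proof idea beyond generalised free fields. Layer-2 children weaker than this are false by §1–§2. -/
def NPointIsotropyRegularModelBlind : Prop :=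
  ∀ (S₁ : SchwingerFamily E4), OSPackage S₁ → Translations S₁ → Hypercubic S₁ →
    (∃ Δ : ℝ, 0 < Δ ∧ S₁.toLabelled.HasMassGap Δ) → EightFrameRP S₁ → RadialKernel S₁ →
    (∀ n : ℕ, ∃ W : (Fin n → E4) → ℂ, ContinuousOn W (coincidenceLocus n E4)ᶜ ∧
      ∀ F : 𝓢((Fin n → E4), ℂ), IsOffDiagonal F →
        MeasureTheory.Integrable (fun x => W x * F x) ∧ S₁ n F = ∫ x, W x * F x) →
    PlanarInvariant S₁

/-- The regular model-blind form implies the model-blind form restricted to regular families — and in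
particular it is NOT refuted by the junk family (whose `𝔖₄ = J` is not given by a continuous function: it
charges the Lebesgue-null 7-plane family). Recorded as the target for layer-2 planners. -/
theorem regularModelBlind_of_modelBlind (h : NPointIsotropyModelBlind) : NPointIsotropyRegularModelBlind :=
  fun S₁ hOS htr hhyp hgap h8 hK _ => h S₁ ⟨hOS, htr, hhyp, hgap⟩ h8 hK

/-! ## §11 (cycle 3) THE BORCHERS-CLASS NO-GO — theorem, all orders

**Setting.** Independent generalised free fields `φ_1, …, φ_r` on `ℝ⁴`, each reflection positive in the `e₀` direction,
with covariances `K̂_a(p) = A_a(p)/(p² + m_a²)`, `m_a > 0`, `A_a` a real polynomial that is `≥ 0` on the `e₀`-shell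
`{(iω_a(p⃗), p⃗)}` (where it is automatically real when `A_a` is `θ₀`-even). `A ≡ 1`: free field; `A = N²`: the
derivative field `N(−i∂)φ` (§7b(i), DREFUTE §B: `RP` in direction `u` iff `N` is `θ_u`-even, the residue `N(iωu+q)²`
being a real square); `A = 1 + ε e₂(p_μ²)²`: the sixteen-frame-RP dressed Gaussian of `Unbundled.lean`. (Källén–Lehmann
superpositions in `m`: same proof, with integrals of positive semi-definite forms.) Let `s` be a HERMITIAN LOCAL WICK
POLYNOMIAL in the `φ_a` and their derivatives — finitely many terms, arbitrary orders, arbitrary chaos degrees. Write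
`v := s(0)Ω = Σ_σ v_σ` over sectors `σ` (species multi-indices); `v_σ` has an on-shell wave function ("symbol") `M̄_σ`, a
polynomial function on `∏_i H_{m_{a_i}}` (mass hyperboloids) modulo the shell ideals (null fields).

**THEOREM.** If the Schwinger two-point function of `s` is `O(4)`-invariant OFF THE ORIGIN (the `RadialKernel` clause;
contact terms at `0` are free), then for every sector `σ` the polynomial `g_σ := |M̄_σ|² ∏_i A_{a_i}(p_i)` on
`∏_i H_{m_{a_i}}` is invariant under the proper orthochronous Lorentz group acting diagonally. Consequently
(i) every sector containing a constituent whose dressing `A_a` is non-constant on the complex shell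
`𝒬_a = {p ∈ ℂ⁴ : p² + m_a² = 0}` is ABSENT (`M̄_σ = 0`): genuinely anisotropic dressed fields never enter a composite with
radial two-point function; (ii) if `s` is a `W(B₄)`-scalar (real symbols), every remaining `M̄_σ` is Lorentz-invariant
on shell, i.e. `s ≡` an `SO(4)`-scalar Wick polynomial in free fields modulo null fields, and ALL Schwinger functions of
`s` are `SO(4)`-invariant (`O(4)` with the improper elements of `W(B₄)`).
So the falsifier class named in the picked skeleton for `stub_harmonicKill` — "an exactly radial, sixteen-frame-RP,
gapped one-species Wick dressing with an `e^{4iθ}` component in `𝔖₃` or `𝔖₄`" — is EMPTY: all derivative orders, all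
chaos degrees, any number of constituents and masses, cancellations across chaoses included. This supersedes the
cycle-2 search (§7b: bilinear, orders `≤ 8`) and explains its outcome ("complex solution sets of positive dimension,
no real point"): over `ℂ` the positivity of step (3) is void.

**PROOF.** (1) *Radial ⟹ Lorentz-invariant spectral measure.* Let `μ_v` be the joint spectral measure of the free
generators `(H, P⃗)` in `v`. For `x⁰ > 0`, `𝔖₂(x) = ⟨v, e^{−x⁰H + i x⃗·P⃗} v⟩ = ∫ e^{−x⁰E + i x⃗·p⃗} dμ_v =: L(x)` (`s`
Hermitian). `L` is analytic in `x⁰` on `{Re x⁰ > 0}` and on real points a function of `(x⁰)² + |x⃗|²`, so the Euclidean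
rotation generators `x_i∂₀ − x⁰∂_i` kill `L` on the real half-space and, by analytic continuation in `x⁰`, on the
complex one; at `x⁰ = ε + it`, `ε ↓ 0`, they become `−i(x_i∂_t + t∂_i)`: the Wightman distribution
`𝒲(t,x⃗) = ∫ e^{−itE + i x⃗·p⃗} dμ_v` is annihilated by the boost generators, i.e. `μ_v` is `SO⁺(1,3)`-invariant.
[Uses only `e₀`-RP of the ambient space and radiality off `0`; contact terms never enter since `x⁰ > 0`.]
(2) *Sector densities.* `(H,P⃗)` preserve sectors, so `μ_v = Σ_σ μ_{v_σ}`, and `μ_{v_σ}` is the image of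
`g_σ ∏_i dΩ_{m_{a_i}}(p_i)` under `(p_i) ↦ Σ p_i` (the dressing enters through the one-particle measure `A dΩ`). Sectors
with `≥ 2` particles have densities `ρ_σ(P) = ∫_{X^σ_P} g_σ dΦ^σ_P` (`X^σ_P = {Σp_i = P} ∩ ∏H` compact, `dΦ` the induced
invariant measure); one-particle sectors are `g_σ`-weighted shell measures; the zero-particle sector is `|⟨s⟩|²δ₀`. The
isometry `J = ⊗_i √A_{a_i}` (dressed one-particle spaces `L²(H, A dΩ)` → undressed `L²(H, dΩ)`) intertwines `(H,P⃗)`, so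
`μ_{Jv} = μ_v`, and `|J v_σ|² = g_σ`; on undressed Fock space the free dynamics IS Lorentz covariant:
`U(Λ)(H,P⃗)U(Λ)⁻¹ = Λ(H,P⃗)`, `U(Λ)` preserves sectors, `|U(Λ)J v_σ|² = g_σ ∘ Λ⁻¹`. Invariance of `μ_v` gives
`μ_{U(Λ)Jv} = Λ_*μ_{Jv} = μ_{Jv}`, hence, comparing absolutely continuous and shell parts (Lebesgue decomposition is
unique; shells of different masses are disjoint), `Σ_σ ∫_{X^σ_P} (g_σ∘Λ − g_σ) dΦ^σ_P = 0` for a.e. `P` and every `Λ`,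
and `Σ_{σ one-particle of mass m} (g_σ∘Λ − g_σ) = 0` on `H_m`.
(3) *Weights and positivity.* Fix a boost `Λ_η = e^{ηK}`. The `g_σ` lie in a finite-dimensional `Λ`-stable space of
polynomial functions on which `K` acts diagonalisably with real weights (light-cone monomials), `g_σ = Σ_w (g_σ)_w`,
`g_σ∘Λ_η = Σ_w e^{wη}(g_σ)_w`. Let `w*` be the largest weight occurring in any `g_σ`. From `g_σ∘Λ_η ≥ 0` pointwise for
all `η`: `(g_σ)_{w*} ≥ 0` (divide by `e^{w*η}`, `η → +∞`). The identity of (2) is a constant exponential polynomial in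
`η`; by linear independence of exponentials its `e^{w*η}`-coefficient `Σ_σ ∫_{X_P} (g_σ)_{w*} dΦ` vanishes for a.e. `P`
if `w* ≠ 0` — a sum of integrals of non-negative polynomials, so each `(g_σ)_{w*}` vanishes on a.e. `X_P`, hence
(real-analytic on the connected `∏H`) identically: contradiction. So `w* = 0`, symmetrically the lowest weight is `0`,
every `g_σ` is a weight-`0` vector of every boost generator, `K g_σ = 0` for all boosts, and (`[K_i,K_j] = −ε_{ijk}J_k`)
`𝔰𝔬(1,3) g_σ = 0`: `g_σ` is Lorentz-invariant. ∎ (main claim)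
(i): invariance extends to `SO(4,ℂ)` on the complexification `∏𝒬_{a_i}` (Zariski density); a non-constant regular
function `A` on the smooth affine quadric `𝒬 ≅ SL₂(ℂ)` has a zero `p*` (the units of `ℂ[SL₂]` are the constants,
Rosenlicht); `g_σ` vanishes on `{p₁ = p*} × ∏_{i≥2}𝒬`, and `SO(4,ℂ)` is transitive on `𝒬`, so
`(p₁,p₂,…) = Λ·(p*, Λ⁻¹p₂, …)` shows `g_σ ≡ 0`; `ℂ[∏𝒬]` is a domain and no `A_a ≡ 0`, so `M̄_σ = 0`.
(ii): with `M̄_σ` real and the surviving `A`'s constant on shell, `g_σ ∝ M̄_σ²`; if `w` is the top boost weight of `M̄_σ`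
then `M̄_σ²` has top weight `2w` with the non-zero component `(M̄_σ)_w²`, so `w = 0`, and as in (3) `M̄_σ` is Lorentz
invariant on shell; such symbols are exactly those of `SO(4)`-scalar Wick monomials modulo the shell ideals, whose
Schwinger functions are `SO(4)`-invariant.

**REMARKS.** (a) Hypercubic symmetry, the other fifteen frames, the gap and clustering are NOT used: `e₀`-RP of the
constituents and radiality of `⟨ss⟩` alone force isotropy inside this class. (b) Two inputs: Lorentz invariance of
`μ_{Ψ_s}`, which is MODEL-BLIND — step (1) runs verbatim on the OS space of ANY family with `e₀`-RP and `RadialKernel`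
(the kernel `K` is continuous off `0` and radial, the OS matrix element `⟨Ψ_s, e^{−tH}U(a⃗)Ψ_s⟩` is its restriction to
`t > 0`), in each of the sixteen frames; and an AMBIENT boost `U(Λ)` making the sector densities a finite-dimensional
boost-stable positive structure. A general sixteen-frame family has no `U(Λ)`; the line's substitute (band limit = finite
`SO(2)`-type, RP on the imaginary angle axis = non-negativity of top weights, cf. (3)) lacks the IDENTITY of step (2)
that ties `𝔖ₙ`, `n ≥ 3`, to `μ_v`. (c) Where a counterexample to the regular core can still live: OS families in sixteen
frames that are NOT local functions of reflection-positive generalised free fields — in four dimensions nothing of the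
kind is constructible (interacting anisotropic scaling limits = the existence problem; bounded insertions `f(H,P⃗)` in the
free transfer representation keep `e₀`-RP and the `L¹` residual but break E3 = locality, DREFUTE §A.5(e); convex
mixtures break E4; singular additions are excluded by `NPointRegular`; lower-dimensional/axial Gaussian structures and
`ℓ¹`/`ℓ^∞`-type covariances fail the DIAGONAL planar mirrors — e.g. for `e^{−c·max(T,|S|)}` the transverse Fourier
transform `2c e^{−cT}(c sin σT/σ + cos σT)/(c²+σ²)` is negative at `σT = π`).

## §12 (cycle 3) Consequences and hints for the lead

* **Degree 3 is a form-factor problem.** For any family of the crux, in the `e₀`-OS space let `ℋ_v` be the closed span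
  of `{e^{−tH}U(a⃗)Ψ_s}`; `ℋ_v ≅ L²(V₊, μ_v)` with `(H,P⃗)` acting by multiplication, and by §11(1) `μ_v` is Lorentz
  invariant, so `ℋ_v` carries a CANONICAL unitary Lorentz action `(U(Λ)f)(P) = f(Λ⁻¹P)` — although the theory has no
  boosts. For `x⁰ < y⁰ < z⁰`, `𝔖₃(x,y,z) = ⟨e^{−(y⁰−x⁰)H}U(x⃗−y⃗)Ψ_s, ŝ e^{−(z⁰−y⁰)H}U(z⃗−y⃗)Ψ_s⟩` is a matrix element
  of the compression `ŝ` of `s(0)` to `ℋ_v`, i.e. of a kernel `K_s(P,P')` against `μ_v ⊗ μ_v`; by the boundary-value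
  argument of §11(1), `SO(4)`-invariance of `𝔖₃` ⟺ `K_s(ΛP,ΛP') = K_s(P,P')` a.e. So the first non-free degree of
  `stub_harmonicKill` asks for Lorentz invariance of a form factor over Lorentz-invariant measures, to be extracted from:
  Hermiticity of `K_s`; E3 = equality of the three time-ordered representations (crossing); the same structure in the
  `e₁` and diagonal frames (sixteen kernels for one function); positivity of the degree-`≤ 2` OS Gram forms in which `K_s`
  is the off-diagonal block. In the free class `K_s` is explicit and §11 gives invariance; no model-blind argument known.
* **What §11 says about the bet.** Inside the only constructible class the kill is TRUE and needs neither the gap nor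
  the fifteen other frames; outside it there is no candidate. A proof of `stub_harmonicKill` must manufacture the
  identity of §11(2) from band-limitation + sixteen-frame positivity; a refutation must leave local functions of RP
  Gaussian fields (and cannot be a mixture, an insertion, or singular).
* **Certified anchor (§11b, file XI `Negative/RadialBilinearOrderFour.lean`, p83468; kit job `j013980`, exact over
  `ℚ`, script attached as item evidence):** at the first anisotropic order (massless `W(B₄)`-scalar Wick bilinears of
  derivative order 4: symbols `a₁S₄ + a₂S₃₁ + a₃S₂₂ +` null `+ b₄(p·q)²`) radiality of `⟨BB⟩` is exactly THREE quadrics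
  (harmonic degrees 4, 6, 8); the null coefficients never occur, `b₄` only in the lowest; and the TOP one is positive
  DEFINITE in the anisotropic coefficients,
  `Q₈ = 142a₁² + 40a₁a₂ + 10a₁a₃ + 7a₂² + 5a₂a₃ + a₃² = (a₃ + 5a₂/2 + 5a₁)² + ¾(a₂ + 10a₁)² + 42a₁²`
  (`topHarmonic_eq_sum_sq`), so `Q₈ = 0 ⟺ a = 0` (`topHarmonic_eq_zero_iff`) and the whole system `⟺` isotropic mod
  null for every `b₄` (`radialQuadrics_iff`) — step (3) of §11 in miniature; while the LOWER harmonics are not rigid: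
  `(a₁,a₂,a₃,b₄) = (0,2,−3,6/7)` kills `Q₄, Q₆` with `Q₈ = 7` (`lowerHarmonics_not_rigid`), which is why cycle 2 saw
  complex solution branches of positive dimension and no real point.
-/

/-! ## §13 (cycle 3) Structure of sixteen-frame two-point functions (paper; supports stubs 2–4, bounds `K(2)`)

**Anisotropic regular inhabitants exist and are all of one kind.** `W_A := A(−i∂) G_m` off the origin, for a real
polynomial `A` that is `≥ 0` on the sixteen hyperoctahedral mass shells `{iω u + q}` (`u` a mirror normal, `q ⊥ u`
real): smooth off `0`, even, tempered, and RP in pull-back form in all sixteen frames — the `u`-section of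
`A(p)/(p²+m²)` is `A(iω_q u + q)/(p_u² + ω_q²) +` a polynomial (contact terms at `x_u = 0`, invisible on open half-spaces),
and `A(iωu+q)` is REAL whenever `A` is `θ_u`-even (`θ_u(iωu+q) = conj(iωu+q)`), so every real `W(B₄)`-invariant `A = N²`,
or `1 + ε e₂²`, qualifies. These are `O(4)`-FINITE (finitely many spherical harmonics), respect the planar cone
(spectral support on the Lorentzian shell), and their planar orbit functions are trigonometric polynomials of degree
`≤ deg A` — consistent with `stub_entire`/`stub_bandlimit` with `N(2) ~ deg A + 2 =` the order of the singularity at `0`.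
NO non-`O(4)`-finite sixteen-frame two-point function is known, and none exists if the following chain (each link
classical or proved here on paper) is right:
(1) RP along `e₀`, `n = (e₀+e₁)/√2`, `n' = (e₀−e₁)/√2` + continuity off `0` ⟹ PLANAR CONE `supp μ₀ ⊆ {λ ≥ |κ₁|}` for the
`e₀`-spectral measure: `W` is bounded on `{|z·u| ≥ 2δ}` by `W(2δu)` (Cauchy–Schwarz in the `u`-OS form), so
`F(v,v') = W(vn + v'n')` is separately holomorphic and bounded (`Re v ≥ δ`, `v'` real, and symmetrically); the cross
theorem (Bernstein–Siciak; harmonic measure of `(δ,∞)` in the half-plane is `2|arg|/π`) continues `F` boundedly to the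
two-slot sector `{|arg v| + |arg v'| < π/2}`, whose `t`-slices are the discs `|β| < t` (Thales, as in
`Theorems/MirrorModularBoostsPlanarSpectralConeDiscSections.lean`); `b ↦ W(te₀ + be₁) = ν̂_t(b)` is the Fourier transform of
the finite positive measure `ν_t(dκ₁) = ∫ e^{−tλ} μ₀(dλ, dκ₁, dκ⊥)`, analytic and bounded by `M_δ` in the disc, hence
(Lukacs) `∫ e^{σκ₁} dν_t ≤ M_δ` for `|σ| < t − cδ`; a charge of `μ₀` on `{λ < |κ₁| − η, λ ≤ Λ}` would make the left side
`≥ e^{tη − O(1)}` — contradiction as `t → ∞`. [This is the two-point case of `stub_planarCone` = stmt-9664; the 9664 line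
`two-mirror-lightcone-slots` runs the same mechanism on cone chains.]
(2) Cone in the `e₀`- and `e₁`-frames ⟹ for `y` with `π(y) ≠ 0`, `θ ↦ W(R_θ y)` is ENTIRE of exponential type `M'` =
the temperedness order of `μ₀` (`|W| ≤ ∫e^{−(Re t − |Im b|)λ}dμ₀ ≤ C (r cosβ e^{−|χ|})^{−M'}` on the complex circle, the two
frames covering `cos β ≠ 0` / `sin β ≠ 0` and gluing on strips).
(3) Quarter-turn symmetry ⟹ `π/2`-periodic ⟹ (Paley–Wiener, `stub_bandlimit`) a trigonometric polynomial of degree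
`≤ M'/4` in `e^{4iθ}` on EVERY planar circle, uniformly; with the six coordinate planes (hypercubic symmetry) the
`SO(4)`-translates of `W|_{S³}` span a finite-dimensional space: `W` is `O(4)`-finite, angular degree `≤ M'`.
So `AngularBandLimited` holds at `n = 2` for every family of the crux with `K(2) ≤ M'/4`, and "radial" (the crux's
extra hypothesis) is the statement that this finite expansion has only the `ℓ = 0` term. Attempts at non-finite
examples all die on the way: infinite sums `Σ c_k A_k(−i∂)G` with `deg A_k → ∞` have an essential singularity at `0`
(not a distribution); rational anisotropic denominators lose purely-imaginary section roots at large transverse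
momentum (diagonal RP fails); lower-dimensional / axial / `ℓ¹`, `ℓ^∞` covariances fail the diagonal mirrors (§11(c)).

**Certified engine.** The weight/positivity step (3) of §11 and the imaginary-axis positivity of the line's kill are
the lemmas of `Theorems/NPointIsotropy/Negative/BoostWeights.lean` (cycle 3): `coeff_top_nonneg`, `coeff_bot_nonneg`
(a pointwise non-negative real exponential sum `Σ_{|k|≤K} c_k e^{kχ}` has non-negative extreme coefficients),
`coeff_eq_zero_of_expSum_const` (a constant one has no non-zero weight), `coeff_top_eq_zero_of_nonneg_of_sum_const`
(non-negative family with constant sum ⟹ all extreme coefficients vanish).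
-/

/-- **§13 certified engine (file X `Negative/BoostWeights.lean`, p75942 ACCEPTED, cycle 3)**: a pointwise
non-negative real exponential sum has non-negative extreme coefficients — the imaginary-axis positivity step of the
line's kill and of §11(3); with `coeff_top_eq_zero_of_nonneg_of_sum_const` (non-negative family, constant sum ⟹ all
extreme coefficients vanish) this is the whole finite-dimensional engine. -/
example {c : ℤ → ℝ} {K : ℕ} (h : ∀ χ : ℝ, 0 ≤ ∑ k ∈ Finset.Icc (-(K : ℤ)) K, c k * Real.exp (k * χ)) :
    0 ≤ c K ∧ 0 ≤ c (-K) :=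
  ⟨BoostWeights.coeff_top_nonneg h, BoostWeights.coeff_bot_nonneg h⟩

/-- **§12 bookkeeping.** The regular model-blind form with the `L¹` (function) residual — exactly what stubs 2–6 of the
picked line prove (`Lines/complex-rotation-bandlimit.lean: regularModelBlind_of_stubs`, gen 2). -/
def NPointIsotropyRegularModelBlindL1 : Prop :=
  ∀ (S₁ : SchwingerFamily E4), OSPackage S₁ → Translations S₁ → Hypercubic S₁ →
    (∃ Δ : ℝ, 0 < Δ ∧ S₁.toLabelled.HasMassGap Δ) → EightFrameRP S₁ → RadialKernel S₁ →
    (∀ n : ℕ, ∃ W : (Fin n → E4) → ℂ, ∀ F : 𝓢((Fin n → E4), ℂ), IsOffDiagonal F →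
        MeasureTheory.Integrable (fun x => W x * F x) ∧ S₁ n F = ∫ x, W x * F x) →
    PlanarInvariant S₁

/-- The `L¹` form implies the continuity-residual form of §7b (weaker hypothesis ⟹ stronger statement): the gen-2 line,
if completed, proves `NPointIsotropyRegularModelBlind` as well. Neither is refuted; §11 empties their common falsifier
class. -/
theorem regularModelBlind_of_L1 (h : NPointIsotropyRegularModelBlindL1) : NPointIsotropyRegularModelBlind :=
  fun S₁ hOS htr hhyp hgap h8 hK hreg => h S₁ hOS htr hhyp hgap h8 hK fun n => by
    obtain ⟨W, -, hW⟩ := hreg n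
    exact ⟨W, hW⟩

end Summit.QuantumFields.YangMills.Cruxes.NPointIsotropy.Disproof

end
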